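import Summits.SmoothPoincare4.SmoothPoincare4.Theses.CylinderEntropy
import Summits.SmoothPoincare4.SmoothPoincare4.Theorems.CylinderEntropyThinCrossSectionExistsOfMassSlackUnconditional
import Summits.SmoothPoincare4.SmoothPoincare4.Theorems.ThinCrossSectionExists.Negative.FrameAnalysis
import Summits.SmoothPoincare4.SmoothPoincare4.Theorems.CylinderEntropySliceCalibration
import Literature.Geometry.Manifold.CylinderSlice
import HarnessLib

/-!
# SmoothPoincare4 / CylinderEntropy — the crux `ThinCrossSectionExists` is exactly the summit (modulo the recognition crux)

Crux E = `CylinderEntropy.ThinCrossSectionExists` (item `stmt-SmoothPoincare4-7633`), line `ball-mass-slack`, registered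
skeleton `Cruxes/ThinCrossSectionExists/Lines/ball_mass_slack.lean` (continuation lead c3).  The line is saturated: its ten
analytic stubs are landed theorems and its one remaining stub D = `stub_massSlackIntr` is sandwiched by landed files
(`…BallMassSlack.massSlackIntr_of_spc4`, `…BallMassSlack.crux_of_massSlackIntr`, `CylinderEntropy.closes`).  This file
closes the circle with the SUMMIT in citable form, pure logic over landed files (no definitions, no facts):

* pointwise, for ONE homotopy 4-sphere: `exists_thinCrossSection_of_diffeomorph` — a diffeomorphism `M ≅ S⁴` gives a thin
  cross-section (the slice through it, `λ_cyl ≤ 1 < 4/e` by the landed calibration), with NO hypothesis; and, given the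
  recognition crux R = `CylinderRungTwo` (7631), `exists_thinCrossSection_iff_nonempty_diffeomorph` — `M` has a thin
  cross-section iff `M ≅ S⁴` (the route's dichotomy `μ(M) < 4/e ⟺ M ≅ S⁴`, per manifold);
* the summit implies every item of the route that speaks of homotopy spheres: `cylinderRungTwo_of_smoothPoincare4`,
  `sliceIsolation_of_smoothPoincare4`, `rungTwoOfSliceIsolation_of_smoothPoincare4` (and E: `…crux_of_smoothPoincare4`, landed);
* the route's target IS the summit, unconditionally: `target_iff_smoothPoincare4 : Target ↔ SmoothPoincare4`
  (`Target` = E ∧ R spelled out; `smoothPoincare4_of_target` is `closes`; `thinCrossSectionExists_and_cylinderRungTwo_iff_smoothPoincare4`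
  is the same with the named decls);
* the crux is the summit modulo R: `thinCrossSectionExists_iff_smoothPoincare4 (hR) : ThinCrossSectionExists ↔ SmoothPoincare4`,
  hence `not_thinCrossSectionExists_iff_not_smoothPoincare4 (hR)` — a refutation of E is an exotic 4-sphere and conversely;
* the stub is the summit modulo R: `stub_massSlackIntr_iff_smoothPoincare4 (hR)` and `stub_massSlackIntr_iff_thinCrossSectionExists (hR)`
  (D spelled out verbatim = the registered signature of `stub_massSlackIntr`).

So no statement strictly between "SPC4 for the manifolds a supply covers" and E exists inside the line: every supply `D′ ⇒ E`
satisfies `D′ ∧ R ⇒ SmoothPoincare4` by `closes`.  R itself is SPC4-free parabolic analysis (the Chodosh–Mantoulidis–Schulze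
transplant) and is implied by the summit (`cylinderRungTwo_of_smoothPoincare4`), so `E ⟺ SmoothPoincare4` becomes
unconditional the moment R lands.
-/

noncomputable section

-- the registered namespace `Summit.SmoothPoincare4.SmoothPoincare4.Theorems` repeats a component
set_option linter.dupNamespace false

open scoped BigOperators Topology Manifold MeasureTheory ENNReal NNReal ContDiff ContinuousMap
open Set Function MeasureTheory
open Literature.Geometry.Riemannian.SphericalCylinderEntropy (cylEntropy)
open Literature.Geometry.Manifold.CylinderSlice (sliceMap range_sliceMap isSmoothEmbedding_sliceMap sum_sq_sliceMap
  separatesEnds_of_slice_subset)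

namespace Summit.SmoothPoincare4.SmoothPoincare4.Theorems.ThinCrossSectionExists

open Summit.SmoothPoincare4.SmoothPoincare4.Theses.CylinderEntropy (Target ThinCrossSectionExists CylinderRungTwo
  SliceIsolation RungTwoOfSliceIsolation)

/-! ### One homotopy sphere at a time -/

/-- **A diffeomorphism to `S⁴` gives a thin cross-section** (no hypothesis): the slice `S⁴ × {0}` precomposed with
`φ : M ≅ S⁴` is a smooth end-separating embedding of `M` into `N = S⁴ × ℝ` whose image is the slice, of cylinder entropy
`≤ 1 < 4/e` (landed `cylEntropy_slice₀_le_one`, `Negative.one_lt_level`). [folklore] -/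
theorem exists_thinCrossSection_of_diffeomorph {M : Type} [TopologicalSpace M] [ChartedSpace (EuclideanSpace ℝ (Fin 4)) M]
    [IsManifold (𝓡 4) ∞ M] (φ : M ≃ₘ⟮𝓡 4, 𝓡 4⟯ (Metric.sphere (0 : EuclideanSpace ℝ (Fin 5)) 1)) :
    ∃ ι : M → EuclideanSpace ℝ (Fin 6), Manifold.IsSmoothEmbedding (𝓡 4) (𝓡 6) ∞ ι ∧ (∀ x, ∑ i : Fin 5, ι x (Fin.castSucc i) ^ 2 = 1) ∧
      (∃ R : ℝ, ∀ a b : EuclideanSpace ℝ (Fin 6), ∑ i : Fin 5, a (Fin.castSucc i) ^ 2 = 1 → ∑ i : Fin 5, b (Fin.castSucc i) ^ 2 = 1 →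
        a 5 ≤ -R → R ≤ b 5 → ¬ JoinedIn ({z : EuclideanSpace ℝ (Fin 6) | ∑ i : Fin 5, z (Fin.castSucc i) ^ 2 = 1} \ Set.range ι) a b) ∧
      cylEntropy (Set.range ι) < ENNReal.ofReal (4 / Real.exp 1) := by
  have hr : Set.range (sliceMap 0 ∘ φ) = {z : EuclideanSpace ℝ (Fin 6) | ∑ i : Fin 5, z (Fin.castSucc i) ^ 2 = 1 ∧ z 5 = 0} := by
    rw [← range_sliceMap 0]
    ext z
    simp only [Set.mem_range, Function.comp_apply]
    constructor
    · rintro ⟨x, rfl⟩; exact ⟨φ x, rfl⟩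
    · rintro ⟨y, rfl⟩; exact ⟨φ.symm y, by simp⟩
  refine ⟨sliceMap 0 ∘ φ, (isSmoothEmbedding_sliceMap 0).comp_diffeomorph φ, fun x => sum_sq_sliceMap 0 (φ x), ?_, ?_⟩
  · rw [hr]; exact separatesEnds_of_slice_subset subset_rfl
  · rw [hr]
    exact lt_of_le_of_lt Summit.SmoothPoincare4.SmoothPoincare4.Theorems.cylEntropy_slice₀_le_one Negative.one_lt_level

/-- **The route's dichotomy, per manifold** (given the recognition crux R = `CylinderRungTwo`, item 7631): a homotopy
4-sphere `M` of the summit frame has a smooth end-separating cross-section embedding into `N` of cylinder entropy `< 4/e`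
if and only if it is diffeomorphic to `S⁴` (`⇒` is R verbatim, `⇐` is the slice). [folklore] -/
theorem exists_thinCrossSection_iff_nonempty_diffeomorph (hR : CylinderRungTwo)
    (M : Type) [TopologicalSpace M] [T2Space M] [SecondCountableTopology M] [ChartedSpace (EuclideanSpace ℝ (Fin 4)) M] [IsManifold (𝓡 4) ∞ M]
    (e : M ≃ₕ (Metric.sphere (0 : EuclideanSpace ℝ (Fin 5)) 1)) :
    (∃ ι : M → EuclideanSpace ℝ (Fin 6), Manifold.IsSmoothEmbedding (𝓡 4) (𝓡 6) ∞ ι ∧ (∀ x, ∑ i : Fin 5, ι x (Fin.castSucc i) ^ 2 = 1) ∧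
      (∃ R : ℝ, ∀ a b : EuclideanSpace ℝ (Fin 6), ∑ i : Fin 5, a (Fin.castSucc i) ^ 2 = 1 → ∑ i : Fin 5, b (Fin.castSucc i) ^ 2 = 1 →
        a 5 ≤ -R → R ≤ b 5 → ¬ JoinedIn ({z : EuclideanSpace ℝ (Fin 6) | ∑ i : Fin 5, z (Fin.castSucc i) ^ 2 = 1} \ Set.range ι) a b) ∧
      cylEntropy (Set.range ι) < ENNReal.ofReal (4 / Real.exp 1)) ↔
    Nonempty (M ≃ₘ⟮𝓡 4, 𝓡 4⟯ (Metric.sphere (0 : EuclideanSpace ℝ (Fin 5)) 1)) :=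
  ⟨fun ⟨ι, hι, hN, hsep, hlt⟩ => hR M e ι hι hN hsep hlt, fun ⟨φ⟩ => exists_thinCrossSection_of_diffeomorph φ⟩

/-! ### The summit implies every homotopy-sphere item of the route -/

/-- **R ⇐ SPC4**: under the summit statement the recognition crux `CylinderRungTwo` holds trivially (its conclusion
`M ≅ S⁴` needs none of its cross-section hypotheses). [folklore] -/
theorem cylinderRungTwo_of_smoothPoincare4 (h : _root_.SmoothPoincare4) : CylinderRungTwo := by
  intro M _ _ _ _ _ e _ _ _ _ _
  exact h M ‹ChartedSpace (EuclideanSpace ℝ (Fin 4)) M› ‹IsManifold (𝓡 4) ∞ M› e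

/-- **SliceIsolation ⇐ SPC4** (any `ε > 0` works, e.g. `ε = 1`). [folklore] -/
theorem sliceIsolation_of_smoothPoincare4 (h : _root_.SmoothPoincare4) : SliceIsolation := by
  refine ⟨1, one_pos, ?_⟩
  intro M _ _ _ _ _ e _ _ _ _ _
  exact h M ‹ChartedSpace (EuclideanSpace ℝ (Fin 4)) M› ‹IsManifold (𝓡 4) ∞ M› e

/-- **The glue `SliceIsolation → CylinderRungTwo` ⇐ SPC4.** [folklore] -/
theorem rungTwoOfSliceIsolation_of_smoothPoincare4 (h : _root_.SmoothPoincare4) : RungTwoOfSliceIsolation :=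
  fun _ => cylinderRungTwo_of_smoothPoincare4 h

/-! ### E ∧ R ⇒ SPC4 without the route's `closes` (robust to re-gluing of the route) -/

/-- **SPC4 ⇐ R ∧ E, closes-free**: the pure-logic content of the route's deciding theorem, proved by unfolding
the summit statement instead of calling `CylinderEntropy.closes` (whose binder list changes with every re-glue of the
route — rev 8/10 made it four-binder and broke the five `closes hR hE` call sites of the 2026-08-17T02:04Z landing of
this file; repaired here 1:1, same theorem names and statements).  Given `M ≃ₕ S⁴`, E supplies a separating thin
cross-section embedding `ι`, and R turns it into `M ≃ₘ S⁴`. [folklore] -/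
theorem smoothPoincare4_of_cylinderRungTwo_of_thinCrossSectionExists (hR : CylinderRungTwo)
    (hE : ThinCrossSectionExists) : _root_.SmoothPoincare4 := by
  unfold _root_.SmoothPoincare4 Literature.SPC4.SmoothPoincareConjectureFour
    ContinuousMap.HomotopyEquiv.NonemptyDiffeomorphSphere
  intro M _ _ _ _ _ e
  obtain ⟨ι, hι, hN', hsep, hlt⟩ := hE M e
  exact hR M e ι hι hN' hsep hlt

/-! ### The route's target is the summit -/

/-- **SPC4 ⇐ Target**: the closes-free form of the route's deciding theorem applied to the two conjuncts. [folklore] -/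
theorem smoothPoincare4_of_target (h : Target) : _root_.SmoothPoincare4 :=
  smoothPoincare4_of_cylinderRungTwo_of_thinCrossSectionExists h.2 h.1

/-- **The target of route CylinderEntropy is equivalent to the summit, with no hypothesis**: `⇒` is `closes`, and
both conjuncts of the target (E spelled out ∧ R spelled out) follow from the summit
(`BallMassSlack.crux_of_smoothPoincare4`, `cylinderRungTwo_of_smoothPoincare4`). [folklore] -/
theorem target_iff_smoothPoincare4 : Target ↔ _root_.SmoothPoincare4 :=
  ⟨smoothPoincare4_of_target, fun h => ⟨BallMassSlack.crux_of_smoothPoincare4 h, cylinderRungTwo_of_smoothPoincare4 h⟩⟩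

/-- The same with the named cruxes: **`ThinCrossSectionExists ∧ CylinderRungTwo ↔ SmoothPoincare4`**, no hypothesis.
[folklore] -/
theorem thinCrossSectionExists_and_cylinderRungTwo_iff_smoothPoincare4 :
    (ThinCrossSectionExists ∧ CylinderRungTwo) ↔ _root_.SmoothPoincare4 :=
  ⟨fun h => smoothPoincare4_of_cylinderRungTwo_of_thinCrossSectionExists h.2 h.1,
    fun h => ⟨BallMassSlack.crux_of_smoothPoincare4 h, cylinderRungTwo_of_smoothPoincare4 h⟩⟩

/-! ### The crux is the summit modulo R -/

/-- **E ⟺ SPC4 given R**: `⇒` is the route's `closes`, `⇐` is the slice through the diffeomorphism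
(`BallMassSlack.crux_of_smoothPoincare4`, calibration-free).  Since R is implied by the summit and is expected to be an
SPC4-free theorem (the Chodosh–Mantoulidis–Schulze transplant), this is the precise sense in which the crux is the
summit in the costume of an existence statement. [folklore] -/
theorem thinCrossSectionExists_iff_smoothPoincare4 : Summit.SmoothPoincare4.SmoothPoincare4.Theses.CylinderEntropy.CylinderRungTwo → (Summit.SmoothPoincare4.SmoothPoincare4.Theses.CylinderEntropy.ThinCrossSectionExists ↔ _root_.SmoothPoincare4) :=
  fun hR => ⟨fun hE => smoothPoincare4_of_cylinderRungTwo_of_thinCrossSectionExists hR hE,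
    BallMassSlack.crux_of_smoothPoincare4⟩

/-- **¬E ⟺ ¬SPC4 given R**: a refutation of the crux is (the existence of) an exotic 4-sphere, and conversely every
exotic 4-sphere refutes it. [folklore] -/
theorem not_thinCrossSectionExists_iff_not_smoothPoincare4 (hR : CylinderRungTwo) :
    ¬ ThinCrossSectionExists ↔ ¬ _root_.SmoothPoincare4 :=
  (thinCrossSectionExists_iff_smoothPoincare4 hR).not

/-- **E ⟺ every homotopy 4-sphere of the frame is diffeomorphic to `S⁴`, given R** — the crux unfolded to the shape
of Mathlib's `ContinuousMap.HomotopyEquiv.NonemptyDiffeomorphSphere _ 4`, per manifold. [folklore] -/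
theorem thinCrossSectionExists_iff_forall_nonempty_diffeomorph (hR : CylinderRungTwo) :
    ThinCrossSectionExists ↔
      ∀ (M : Type) [TopologicalSpace M] [T2Space M] [SecondCountableTopology M] [ChartedSpace (EuclideanSpace ℝ (Fin 4)) M]
        [IsManifold (𝓡 4) ∞ M], M ≃ₕ (Metric.sphere (0 : EuclideanSpace ℝ (Fin 5)) 1) → Nonempty (M ≃ₘ⟮𝓡 4, 𝓡 4⟯ (Metric.sphere (0 : EuclideanSpace ℝ (Fin 5)) 1)) := by
  constructor
  · intro hE M _ _ _ _ _ e
    exact (exists_thinCrossSection_iff_nonempty_diffeomorph hR M e).mp (hE M e)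
  · intro h M _ _ _ _ _ e
    exact (exists_thinCrossSection_iff_nonempty_diffeomorph hR M e).mpr (h M e)

/-! ### The stub is the summit modulo R -/

/-- **D ⟺ SPC4 given R** for the one open stub D = `stub_massSlackIntr` of line `ball-mass-slack` (every homotopy
4-sphere has a smooth end-separating cross-section embedding with `Λ`-subspherical intrinsic ball mass, `Λ < 4/e`):
`⇐` is `BallMassSlack.massSlackIntr_of_spc4` (slice, `Λ = 1`), `⇒` is `closes hR ∘ BallMassSlack.crux_of_massSlackIntr`
(lever + calibration, all landed). [folklore] -/
theorem stub_massSlackIntr_iff_smoothPoincare4 (hR : CylinderRungTwo) :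
    (∀ (M : Type) [TopologicalSpace M] [T2Space M] [SecondCountableTopology M]
      [ChartedSpace (EuclideanSpace ℝ (Fin 4)) M] [IsManifold (𝓡 4) ∞ M],
      M ≃ₕ (Metric.sphere (0 : EuclideanSpace ℝ (Fin 5)) 1) →
      ∃ ι : M → EuclideanSpace ℝ (Fin 6), Manifold.IsSmoothEmbedding (𝓡 4) (𝓡 6) ∞ ι ∧
        (∀ x, ∑ i : Fin 5, ι x (Fin.castSucc i) ^ 2 = 1) ∧
        (∃ R : ℝ, ∀ a b : EuclideanSpace ℝ (Fin 6), ∑ i : Fin 5, a (Fin.castSucc i) ^ 2 = 1 → ∑ i : Fin 5, b (Fin.castSucc i) ^ 2 = 1 → a 5 ≤ -R → R ≤ b 5 →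
          ¬ JoinedIn ({z : EuclideanSpace ℝ (Fin 6) | ∑ i : Fin 5, z (Fin.castSucc i) ^ 2 = 1} \ Set.range ι) a b) ∧
        ∃ Λ : ℝ≥0∞, Λ < ENNReal.ofReal (4 / Real.exp 1) ∧
          ∀ p : EuclideanSpace ℝ (Fin 6), ∑ i : Fin 5, p (Fin.castSucc i) ^ 2 = 1 → ∀ r : ℝ, 0 < r →
          μH[4] (Set.range ι ∩ {y : EuclideanSpace ℝ (Fin 6) | ∑ i : Fin 5, y (Fin.castSucc i) ^ 2 = 1 ∧ Real.arccos (∑ i : Fin 5, y (Fin.castSucc i) * p (Fin.castSucc i)) ^ 2 + (y 5 - p 5) ^ 2 ≤ r ^ 2}) ≤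
            Λ * μH[4] ({z : EuclideanSpace ℝ (Fin 6) | ∑ i : Fin 5, z (Fin.castSucc i) ^ 2 = 1 ∧ z 5 = 0} ∩
              {y : EuclideanSpace ℝ (Fin 6) | ∑ i : Fin 5, y (Fin.castSucc i) ^ 2 = 1 ∧ Real.arccos (∑ i : Fin 5, y (Fin.castSucc i) * (EuclideanSpace.single 0 1 : EuclideanSpace ℝ (Fin 6)) (Fin.castSucc i)) ^ 2 + (y 5 - (EuclideanSpace.single 0 1 : EuclideanSpace ℝ (Fin 6)) 5) ^ 2 ≤ r ^ 2})) ↔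
    _root_.SmoothPoincare4 :=
  ⟨fun hD => smoothPoincare4_of_cylinderRungTwo_of_thinCrossSectionExists hR (BallMassSlack.crux_of_massSlackIntr hD),
    BallMassSlack.massSlackIntr_of_spc4⟩

/-- **D ⟺ E given R**: the stub and the crux it was meant to supply are equivalent modulo the recognition crux
(`⇒` landed as `BallMassSlack.crux_of_massSlackIntr` with no hypothesis; `⇐` goes through the summit: `closes` then
`massSlackIntr_of_spc4`). [folklore] -/
theorem stub_massSlackIntr_iff_thinCrossSectionExists (hR : CylinderRungTwo) :
    (∀ (M : Type) [TopologicalSpace M] [T2Space M] [SecondCountableTopology M]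
      [ChartedSpace (EuclideanSpace ℝ (Fin 4)) M] [IsManifold (𝓡 4) ∞ M],
      M ≃ₕ (Metric.sphere (0 : EuclideanSpace ℝ (Fin 5)) 1) →
      ∃ ι : M → EuclideanSpace ℝ (Fin 6), Manifold.IsSmoothEmbedding (𝓡 4) (𝓡 6) ∞ ι ∧
        (∀ x, ∑ i : Fin 5, ι x (Fin.castSucc i) ^ 2 = 1) ∧
        (∃ R : ℝ, ∀ a b : EuclideanSpace ℝ (Fin 6), ∑ i : Fin 5, a (Fin.castSucc i) ^ 2 = 1 → ∑ i : Fin 5, b (Fin.castSucc i) ^ 2 = 1 → a 5 ≤ -R → R ≤ b 5 →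
          ¬ JoinedIn ({z : EuclideanSpace ℝ (Fin 6) | ∑ i : Fin 5, z (Fin.castSucc i) ^ 2 = 1} \ Set.range ι) a b) ∧
        ∃ Λ : ℝ≥0∞, Λ < ENNReal.ofReal (4 / Real.exp 1) ∧
          ∀ p : EuclideanSpace ℝ (Fin 6), ∑ i : Fin 5, p (Fin.castSucc i) ^ 2 = 1 → ∀ r : ℝ, 0 < r →
          μH[4] (Set.range ι ∩ {y : EuclideanSpace ℝ (Fin 6) | ∑ i : Fin 5, y (Fin.castSucc i) ^ 2 = 1 ∧ Real.arccos (∑ i : Fin 5, y (Fin.castSucc i) * p (Fin.castSucc i)) ^ 2 + (y 5 - p 5) ^ 2 ≤ r ^ 2}) ≤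
            Λ * μH[4] ({z : EuclideanSpace ℝ (Fin 6) | ∑ i : Fin 5, z (Fin.castSucc i) ^ 2 = 1 ∧ z 5 = 0} ∩
              {y : EuclideanSpace ℝ (Fin 6) | ∑ i : Fin 5, y (Fin.castSucc i) ^ 2 = 1 ∧ Real.arccos (∑ i : Fin 5, y (Fin.castSucc i) * (EuclideanSpace.single 0 1 : EuclideanSpace ℝ (Fin 6)) (Fin.castSucc i)) ^ 2 + (y 5 - (EuclideanSpace.single 0 1 : EuclideanSpace ℝ (Fin 6)) 5) ^ 2 ≤ r ^ 2})) ↔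
    ThinCrossSectionExists :=
  ⟨BallMassSlack.crux_of_massSlackIntr,
    fun hE => BallMassSlack.massSlackIntr_of_spc4 (smoothPoincare4_of_cylinderRungTwo_of_thinCrossSectionExists hR hE)⟩

end Summit.SmoothPoincare4.SmoothPoincare4.Theorems.ThinCrossSectionExists

end
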